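import Literature.MathematicalPhysics.KineticTheory.CollisionTubePullbackGeometry
import Literature.MathematicalPhysics.KineticTheory.CollisionTubePullbackFlight
import HarnessLib

/-!
# The collision-cylinder pull-back along hard-sphere orbits, IV: one stretch of a pair

For an ordered pair `(i, j)` and a stretch `(a, b)` of a good orbit on which neither partner collides:
if `b` is a collision of the pair, the tube term of `(i, j)` equals the weight times the collision mark
on the last `κε` of the stretch and vanishes before (`tubeTerm_orbit_eq_of_collision` — CIP 1994 §2.2
read backwards from the collision, `tube_backward`; a predicted contact inside a free stretch would be a
real one, `tube_forward`); otherwise a nonzero tube term lives on the last `κε` and forces the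
near-contact shell at `b` (`tubeTerm_orbit_fake`).  Plus the partition of `(0, τ]` by a finite set of
break points (`setIntegral_Icc_eq_sum_pieces`) and the break points of a pair
(`pairPieces_hyps`, from `pairFlightStart`).

## References

* C. Cercignani, R. Illner, M. Pulvirenti, *The Mathematical Theory of Dilute Gases* (1994), §2.2
  (Boltzmann's collision cylinder: the molecules about to hit a given one within time `dt` fill the
  cylinder of height `|V · n| dt` over the protection sphere; pre-collisional hemisphere `V · n < 0`).
  [CIPDiluteGases1994]
* I. Gallagher, L. Saint-Raymond, B. Texier, *From Newton to Boltzmann* (2013), Part II Ch. 4, §4.1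
  (the hard-sphere flow: free flow between collisions, elastic reflection at `|xᵢ − xⱼ| = ε`,
  pre-collisional iff `νⁱʲ · (vᵢ − vⱼ) < 0`; Prop. 4.1.1, Def. 4.1.2). [GallagherSaintRaymondTexier2013]
-/

noncomputable section

open scoped BigOperators Classical InnerProductSpace ENNReal Topology
open Set MeasureTheory Filter Function
open Literature.Analysis.FluidPDE

namespace Literature.MathematicalPhysics.KineticTheory

/-! ## The tube term of a pair on one stretch of its orbit -/

section PieceAnalysis

variable {σ : ℝ} {N : ℕ} {Φ : HardSphereFlow (Torus.geometry (Fin 3)) (hsDiameter σ N) (N + 1)}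
  {z : Config (N + 1) (Fin 3) T3} {χ : ℝ × UnitAddTorus (Fin 3) → ℝ} {g : ℝ → ℝ}
  {Ψ : V3 × V3 × V3 → ℝ} {r κ L : ℝ}

/-- **The tube term on a TRUE stretch.**  Let `b` be a collision of the ordered pair `(i, j)`
preceded by flights of `i` and `j` free on `(a, b)`.  Then for `t ∈ (a, b)` the tube term of
`(i, j)` along the orbit is the weight `χ g` read at time `t` times the collision mark at `b` when
`b − κ ε ≤ t` (the pair is in the tube, with predicted hitting time `b − t`, predicted normal the
true one and current velocities the pre-collisional ones), and `0` before (a predicted collision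
inside the free stretch would be a real one).  Marks supported in relative speed `< 2L`,
`ε (1 + 2 L κ) < 1/2` (minimal-image convention). [folklore] -/
theorem tubeTerm_orbit_eq_of_collision (hz : z ∈ Φ.good) {i j : Fin (N + 1)} {a b : ℝ} (hab : a < b)
    (hi : ∀ u ∈ Ioo a b, ¬ Participates (Torus.geometry (Fin 3)) (hsDiameter σ N) (orbit σ N Φ z u) i)
    (hj : ∀ u ∈ Ioo a b, ¬ Participates (Torus.geometry (Fin 3)) (hsDiameter σ N) (orbit σ N Φ z u) j)
    (hp : (i, j) ∈ contactPairs (Torus.geometry (Fin 3)) (hsDiameter σ N) (orbit σ N Φ z b))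
    (hε : 0 < hsDiameter σ N) (hκ : 0 ≤ κ) (hL : 0 ≤ L)
    (hsmall : hsDiameter σ N * (1 + 2 * L * κ) < 1 / 2)
    (hΨ0 : ∀ n v w : V3, 2 * L ≤ ‖w - v‖ → Ψ (n, v, w) = 0) {t : ℝ} (ht : t ∈ Ioo a b) :
    tubeTerm σ N χ g Ψ r κ t (orbit σ N Φ z t) i j =
      if b - κ * hsDiameter σ N ≤ t then
        weightAt σ N χ g r t (orbit σ N Φ z t) i * collMark σ N Ψ (orbit σ N Φ z b) i j
      else 0 := by
  have hij : i ≠ j := (mem_contactPairs.1 hp).1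
  have hqb : ‖sepAt (orbit σ N Φ z b) i j‖ = hsDiameter σ N :=
    ((mem_contactPairs_iff_of_mem (orbit_mem hz b)).1 hp).2
  have hpre := reflectVel_orbit_eq hz hab hi hj hp
  have hin : ⟪sepAt (orbit σ N Φ z b) i j, (orbit σ N Φ z a i).2 - (orbit σ N Φ z a j).2⟫_ℝ < 0 := by
    have h := (isTraj hz).inner_sepVec_preVel_neg hp
    rw [HardSphereCollisionRecord.ofConfig_preVel] at h
    change ⟪sepAt (orbit σ N Φ z b) i j,
      (reflectVel (sepAt (orbit σ N Φ z b) i j) ((orbit σ N Φ z b i).2, (orbit σ N Φ z b j).2)).1 -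
      (reflectVel (sepAt (orbit σ N Φ z b) i j) ((orbit σ N Φ z b i).2, (orbit σ N Φ z b j).2)).2⟫_ℝ < 0
      at h
    rwa [hpre] at h
  have hwv : relVel (orbit σ N Φ z a) i j = (orbit σ N Φ z a i).2 - (orbit σ N Φ z a j).2 := rfl
  have hcm : collMark σ N Ψ (orbit σ N Φ z b) i j =
      Ψ ((hsDiameter σ N)⁻¹ • sepAt (orbit σ N Φ z b) i j, (orbit σ N Φ z a i).2, (orbit σ N Φ z a j).2) := by
    unfold collMark
    rw [hpre]
  obtain ⟨hvi, hvj, hrel⟩ := orbit_vels_eq hz hi hj ⟨ht.1.le, ht.2⟩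
  have hεκ : 0 ≤ κ * hsDiameter σ N := mul_nonneg hκ hε.le
  by_cases hwL : 2 * L ≤ ‖relVel (orbit σ N Φ z a) i j‖
  · -- marks vanish on both sides
    have hΨz : ∀ n, Ψ (n, (orbit σ N Φ z a i).2, (orbit σ N Φ z a j).2) = 0 := fun n =>
      hΨ0 n _ _ (by rwa [← norm_neg, neg_sub, ← hwv])
    rw [hcm, hΨz, mul_zero, ite_self, tubeTerm_eq_ite]
    split_ifs
    · rw [hvi, hvj, hΨz, mul_zero]
    · rfl
  replace hwL := not_le.1 hwL
  by_cases htw : b - κ * hsDiameter σ N ≤ t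
  · rw [if_pos htw]
    have hu0 : 0 < b - t := by linarith [ht.2]
    have huκ : b - t ≤ κ * hsDiameter σ N := by linarith
    have hnorm : ‖sepAt (orbit σ N Φ z b) i j + (t - b) • relVel (orbit σ N Φ z a) i j‖ < 1 / 2 := by
      have h1 : ‖sepAt (orbit σ N Φ z b) i j + (t - b) • relVel (orbit σ N Φ z a) i j‖ ≤
          hsDiameter σ N + (b - t) * ‖relVel (orbit σ N Φ z a) i j‖ := by
        calc ‖sepAt (orbit σ N Φ z b) i j + (t - b) • relVel (orbit σ N Φ z a) i j‖
            ≤ ‖sepAt (orbit σ N Φ z b) i j‖ + ‖(t - b) • relVel (orbit σ N Φ z a) i j‖ := norm_add_le _ _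
          _ = hsDiameter σ N + (b - t) * ‖relVel (orbit σ N Φ z a) i j‖ := by
              rw [hqb, norm_smul, Real.norm_eq_abs, show t - b = -(b - t) by ring, abs_neg, abs_of_pos hu0]
      have h2 := eps_add_mul_le hε.le hκ huκ (norm_nonneg _) hwL.le
      linarith
    have hq : sepAt (orbit σ N Φ z t) i j =
        sepAt (orbit σ N Φ z b) i j - (b - t) • relVel (orbit σ N Φ z a) i j := by
      have h := sepAt_orbit_eq hz hab.le hi hj (t := b) (t' := t) ⟨hab.le, le_rfl⟩ ⟨ht.1.le, ht.2.le⟩ hnorm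
      rw [h]
      have h' : (t - b) • relVel (orbit σ N Φ z a) i j = -((b - t) • relVel (orbit σ N Φ z a) i j) := by
        rw [← neg_smul]; congr 1; ring
      rw [h', ← sub_eq_add_neg]
    obtain ⟨h1, h2, h3, h4, h5⟩ := tube_backward (w := relVel (orbit σ N Φ z a) i j) hqb hin hu0
    rw [tubeTerm_eq_ite, hq, hrel, hvi, hvj]
    rw [if_pos ⟨hij, h1, h2, h3, by unfold hitTime; rw [h4]; exact huκ⟩, hcm]
    unfold hitTime
    rw [h4, h5]
  · rw [if_neg htw]
    replace htw := not_le.1 htw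
    rw [tubeTerm_eq_ite]
    split_ifs with hcond
    · exfalso
      obtain ⟨-, hq, hb', hdisc, hth⟩ := hcond
      rw [hrel] at hb' hdisc hth
      obtain ⟨hth0, hcontact, -⟩ := tube_forward hε hq hb' hdisc
      change 0 < hitTime (hsDiameter σ N) (sepAt (orbit σ N Φ z t) i j) (relVel (orbit σ N Φ z a) i j) at hth0
      change ‖sepAt (orbit σ N Φ z t) i j + hitTime (hsDiameter σ N) (sepAt (orbit σ N Φ z t) i j)
        (relVel (orbit σ N Φ z a) i j) • relVel (orbit σ N Φ z a) i j‖ = hsDiameter σ N at hcontact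
      set th := hitTime (hsDiameter σ N) (sepAt (orbit σ N Φ z t) i j) (relVel (orbit σ N Φ z a) i j)
        with hthdef
      have htb : t + th < b := by linarith
      have hε2 : hsDiameter σ N < 1 / 2 := by nlinarith
      have hnorm : ‖sepAt (orbit σ N Φ z t) i j + (t + th - t) • relVel (orbit σ N Φ z a) i j‖ < 1 / 2 := by
        rwa [add_sub_cancel_left, hcontact]
      have hq' := sepAt_orbit_eq hz hab.le hi hj (t := t) (t' := t + th) ⟨ht.1.le, ht.2.le⟩
        ⟨by linarith [ht.1], htb.le⟩ hnorm
      have hc : ‖sepAt (orbit σ N Φ z (t + th)) i j‖ = hsDiameter σ N := by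
        rw [hq', add_sub_cancel_left, hcontact]
      exact norm_sepAt_ne_of_not_participates hz hij (hi (t + th) ⟨by linarith [ht.1], htb⟩) hc
    · rfl

/-- **The tube term on a stretch NOT ending at a collision of the pair.**  Let the flights of `i`
and `j` be free on `(a, b)` and let `b` NOT be a collision of `(i, j)`.  If the tube term of `(i, j)`
along the orbit is nonzero at some `t ∈ (a, b)`, then `t > b − κ ε` (the predicted collision is
pre-empted at `b`, or lies beyond `b`) and at time `b` the pair sits in the near-contact shell
`ε < ‖q(b)‖ ≤ ε (1 + 2 L κ)`. [folklore] -/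
theorem tubeTerm_orbit_fake (hz : z ∈ Φ.good) {i j : Fin (N + 1)} (hij : i ≠ j) {a b : ℝ} (hab : a < b)
    (hi : ∀ u ∈ Ioo a b, ¬ Participates (Torus.geometry (Fin 3)) (hsDiameter σ N) (orbit σ N Φ z u) i)
    (hj : ∀ u ∈ Ioo a b, ¬ Participates (Torus.geometry (Fin 3)) (hsDiameter σ N) (orbit σ N Φ z u) j)
    (hp : (i, j) ∉ contactPairs (Torus.geometry (Fin 3)) (hsDiameter σ N) (orbit σ N Φ z b))
    (hε : 0 < hsDiameter σ N) (hκ : 0 ≤ κ) (hL : 0 ≤ L)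
    (hsmall : hsDiameter σ N * (1 + 2 * L * κ) < 1 / 2)
    (hΨ0 : ∀ n v w : V3, 2 * L ≤ ‖w - v‖ → Ψ (n, v, w) = 0) {t : ℝ} (ht : t ∈ Ioo a b)
    (hne : tubeTerm σ N χ g Ψ r κ t (orbit σ N Φ z t) i j ≠ 0) :
    b - κ * hsDiameter σ N < t ∧ hsDiameter σ N < ‖sepAt (orbit σ N Φ z b) i j‖ ∧
      ‖sepAt (orbit σ N Φ z b) i j‖ ≤ hsDiameter σ N * (1 + 2 * L * κ) := by
  obtain ⟨hvi, hvj, hrel⟩ := orbit_vels_eq hz hi hj ⟨ht.1.le, ht.2⟩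
  rw [tubeTerm_eq_ite] at hne
  split_ifs at hne with hcond
  swap
  · exact absurd rfl hne
  obtain ⟨-, hq, hb', hdisc, hth⟩ := hcond
  rw [hrel] at hb' hdisc hth hne
  rw [hvi, hvj] at hne
  have hwL : ‖relVel (orbit σ N Φ z a) i j‖ < 2 * L := by
    by_contra hle
    refine hne ?_
    rw [hΨ0 _ _ _ (by rw [← norm_neg, neg_sub]; exact not_lt.1 hle), mul_zero]
  obtain ⟨hth0, hcontact, hbefore⟩ := tube_forward hε hq hb' hdisc
  change 0 < hitTime (hsDiameter σ N) (sepAt (orbit σ N Φ z t) i j) (relVel (orbit σ N Φ z a) i j) at hth0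
  change ‖sepAt (orbit σ N Φ z t) i j + hitTime (hsDiameter σ N) (sepAt (orbit σ N Φ z t) i j)
    (relVel (orbit σ N Φ z a) i j) • relVel (orbit σ N Φ z a) i j‖ = hsDiameter σ N at hcontact
  change ∀ s : ℝ, 0 ≤ s → s < hitTime (hsDiameter σ N) (sepAt (orbit σ N Φ z t) i j) (relVel (orbit σ N Φ z a) i j) →
    hsDiameter σ N < ‖sepAt (orbit σ N Φ z t) i j + s • relVel (orbit σ N Φ z a) i j‖ at hbefore
  set th := hitTime (hsDiameter σ N) (sepAt (orbit σ N Φ z t) i j) (relVel (orbit σ N Φ z a) i j)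
    with hthdef
  have hε2 : hsDiameter σ N < 1 / 2 := by nlinarith
  have hbt : b < t + th := by
    by_contra hle
    replace hle := not_lt.1 hle
    have hnorm : ‖sepAt (orbit σ N Φ z t) i j + (t + th - t) • relVel (orbit σ N Φ z a) i j‖ < 1 / 2 := by
      rwa [add_sub_cancel_left, hcontact]
    have hq' := sepAt_orbit_eq hz hab.le hi hj (t := t) (t' := t + th) ⟨ht.1.le, ht.2.le⟩
      ⟨by linarith [ht.1], hle⟩ hnorm
    have hc : ‖sepAt (orbit σ N Φ z (t + th)) i j‖ = hsDiameter σ N := by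
      rw [hq', add_sub_cancel_left, hcontact]
    rcases hle.lt_or_eq with hlt | heq
    · exact norm_sepAt_ne_of_not_participates hz hij (hi (t + th) ⟨by linarith [ht.1], hlt⟩) hc
    · rw [heq] at hc
      exact hp ((mem_contactPairs_iff_of_mem (orbit_mem hz b)).2 ⟨hij, hc⟩)
  refine ⟨by linarith, ?_⟩
  have hbs : b - t ≤ th := by linarith
  have hbound : hsDiameter σ N + (th - (b - t)) * ‖relVel (orbit σ N Φ z a) i j‖ ≤
      hsDiameter σ N * (1 + 2 * L * κ) := by
    have h1 : (th - (b - t)) * ‖relVel (orbit σ N Φ z a) i j‖ ≤ th * ‖relVel (orbit σ N Φ z a) i j‖ :=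
      mul_le_mul_of_nonneg_right (by linarith [ht.2]) (norm_nonneg _)
    have h2 := eps_add_mul_le hε.le hκ hth (norm_nonneg _) hwL.le
    linarith
  have hnormb : ‖sepAt (orbit σ N Φ z t) i j + (b - t) • relVel (orbit σ N Φ z a) i j‖ < 1 / 2 :=
    lt_of_le_of_lt ((norm_add_smul_le_of_contact hcontact hbs).trans hbound) hsmall
  have hqb : sepAt (orbit σ N Φ z b) i j = sepAt (orbit σ N Φ z t) i j + (b - t) • relVel (orbit σ N Φ z a) i j :=
    sepAt_orbit_eq hz hab.le hi hj (t := t) (t' := b) ⟨ht.1.le, ht.2.le⟩ ⟨hab.le, le_rfl⟩ hnormb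
  rw [hqb]
  exact ⟨hbefore (b - t) (by linarith [ht.2]) (by linarith), (norm_add_smul_le_of_contact hcontact hbs).trans hbound⟩

end PieceAnalysis

/-! ## Partition of `(0, τ]` by a finite set of times and the integral over it -/

section Partition

/-- **Cover.**  Let `T ⊆ [0, τ]` be a finite set of times containing `τ`, and `p : ℝ → ℝ` a
"previous point" map with `0 ≤ p b`, `p b < b`, `p b ∈ T` and no point of `T` strictly between
`p b` and `b`, for every `b ∈ T` with `0 < b`.  Then `(0, τ] = ⋃_{b ∈ T} (p b, b]`. [folklore] -/
theorem Ioc_eq_biUnion_pieces {T : Finset ℝ} {τ : ℝ} {p : ℝ → ℝ} (hτ : τ ∈ T)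
    (hT : ∀ b ∈ T, 0 ≤ b ∧ b ≤ τ) (hp0 : ∀ b ∈ T, 0 ≤ p b) (hplt : ∀ b ∈ T, 0 < b → p b < b)
    (hpmem : ∀ b ∈ T, 0 < b → p b ∈ T) :
    Ioc 0 τ = ⋃ b ∈ T, Ioc (p b) b := by
  ext t
  simp only [mem_iUnion, mem_Ioc, exists_prop]
  constructor
  · rintro ⟨ht0, htτ⟩
    set S := T.filter fun f => t ≤ f with hS
    have hτS : τ ∈ S := Finset.mem_filter.2 ⟨hτ, htτ⟩
    have hne : S.Nonempty := ⟨τ, hτS⟩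
    set b := S.min' hne with hb
    have hbS : b ∈ S := S.min'_mem hne
    have hbT : b ∈ T := (Finset.mem_filter.1 hbS).1
    have htb : t ≤ b := (Finset.mem_filter.1 hbS).2
    have hb0 : 0 < b := ht0.trans_le htb
    refine ⟨b, hbT, ?_, htb⟩
    by_contra hle
    have hpS : p b ∈ S := Finset.mem_filter.2 ⟨hpmem b hbT hb0, not_lt.1 hle⟩
    exact (not_le.2 (hplt b hbT hb0)) (S.min'_le _ hpS)
  · rintro ⟨b, hbT, hpb, htb⟩
    exact ⟨(hp0 b hbT).trans_lt hpb, htb.trans (hT b hbT).2⟩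

/-- **Disjointness** of the pieces `(p b, b]`, `b ∈ T`, under the "no point of `T` strictly
between `p b` and `b`" hypothesis. [folklore] -/
theorem pairwiseDisjoint_pieces {T : Finset ℝ} {p : ℝ → ℝ} (hp0 : ∀ b ∈ T, 0 ≤ p b)
    (hgap : ∀ b ∈ T, 0 < b → ∀ u ∈ T, ¬ (p b < u ∧ u < b)) :
    Set.Pairwise (↑T : Set ℝ) (Disjoint on fun b => Ioc (p b) b) := by
  intro b₁ hb₁ b₂ hb₂ hne
  rw [Function.onFun, Set.disjoint_left]
  intro t ht₁ ht₂
  have hb₁0 : 0 < b₁ := (hp0 b₁ hb₁).trans_lt (ht₁.1.trans_le ht₁.2)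
  have hb₂0 : 0 < b₂ := (hp0 b₂ hb₂).trans_lt (ht₂.1.trans_le ht₂.2)
  rcases lt_or_gt_of_ne hne with h | h
  · exact hgap b₂ hb₂ hb₂0 b₁ hb₁ ⟨ht₂.1.trans_le ht₁.2, h⟩
  · exact hgap b₁ hb₁ hb₁0 b₂ hb₂ ⟨ht₁.1.trans_le ht₂.2, h⟩

/-- **The integral over `[0, τ]` is the sum of the integrals over the pieces** `(p b, b]`,
`b ∈ T`, for a function integrable on `[0, τ]`. [folklore] -/
theorem setIntegral_Icc_eq_sum_pieces {T : Finset ℝ} {τ : ℝ} {p : ℝ → ℝ} (hτ : τ ∈ T)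
    (hT : ∀ b ∈ T, 0 ≤ b ∧ b ≤ τ) (hp0 : ∀ b ∈ T, 0 ≤ p b) (hplt : ∀ b ∈ T, 0 < b → p b < b)
    (hpmem : ∀ b ∈ T, 0 < b → p b ∈ T) (hgap : ∀ b ∈ T, 0 < b → ∀ u ∈ T, ¬ (p b < u ∧ u < b))
    {f : ℝ → ℝ} (hf : IntegrableOn f (Icc 0 τ)) :
    ∫ t in Icc 0 τ, f t = ∑ b ∈ T, ∫ t in Ioc (p b) b, f t := by
  rw [integral_Icc_eq_integral_Ioc, Ioc_eq_biUnion_pieces hτ hT hp0 hplt hpmem]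
  refine integral_biUnion_finset T (fun b _ => measurableSet_Ioc) (pairwiseDisjoint_pieces hp0 hgap)
    fun b hb => hf.mono_set fun t ht => ⟨(hp0 b hb).trans ht.1.le, ht.2.trans (hT b hb).2⟩

end Partition

/-! ## The stretches of a pair along a good orbit -/

section PairPieces

variable {σ : ℝ} {N : ℕ} {Φ : HardSphereFlow (Torus.geometry (Fin 3)) (hsDiameter σ N) (N + 1)}
  {z : Config (N + 1) (Fin 3) T3}

/-- The pair flight start is nonnegative. [folklore] -/
theorem pairFlightStart_nonneg (hz : z ∈ Φ.good) (i j : Fin (N + 1)) (s : ℝ) :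
    0 ≤ pairFlightStart σ N Φ z i j s :=
  le_max_of_le_left (le_flightStart ((isTraj hz).finite_collisionTimesOf_inter_Ioo i 0 s))

/-- The pair flight start is before `s` (for `0 < s`). [folklore] -/
theorem pairFlightStart_lt (hz : z ∈ Φ.good) (i j : Fin (N + 1)) {s : ℝ} (hs : 0 < s) :
    pairFlightStart σ N Φ z i j s < s :=
  max_lt (flightStart_lt ((isTraj hz).finite_collisionTimesOf_inter_Ioo i 0 s) hs)
    (flightStart_lt ((isTraj hz).finite_collisionTimesOf_inter_Ioo j 0 s) hs)

/-- The pair flight start is `0` or a participation time of `i` or `j` in `(0, s)`. [folklore] -/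
theorem pairFlightStart_eq_zero_or (hz : z ∈ Φ.good) (i j : Fin (N + 1)) (s : ℝ) :
    pairFlightStart σ N Φ z i j s = 0 ∨
      (pairFlightStart σ N Φ z i j s ∈ Ioo 0 s ∧
        (Participates (Torus.geometry (Fin 3)) (hsDiameter σ N) (orbit σ N Φ z (pairFlightStart σ N Φ z i j s)) i ∨
          Participates (Torus.geometry (Fin 3)) (hsDiameter σ N) (orbit σ N Φ z (pairFlightStart σ N Φ z i j s)) j)) := by
  unfold pairFlightStart
  rcases le_total (flightStart (Torus.geometry (Fin 3)) (hsDiameter σ N) (orbit σ N Φ z) 0 i s)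
    (flightStart (Torus.geometry (Fin 3)) (hsDiameter σ N) (orbit σ N Φ z) 0 j s) with h | h
  · rw [max_eq_right h]
    rcases mem_insert_iff.1 ((isTraj hz).flightStart_mem 0 j s) with h0 | hm
    · exact Or.inl h0
    · exact Or.inr ⟨hm.2, Or.inr hm.1⟩
  · rw [max_eq_left h]
    rcases mem_insert_iff.1 ((isTraj hz).flightStart_mem 0 i s) with h0 | hm
    · exact Or.inl h0
    · exact Or.inr ⟨hm.2, Or.inl hm.1⟩

/-- **Both flights are free after the pair flight start**: neither `i` nor `j` takes part in a
collision during `(pairFlightStart, s)`. [folklore] -/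
theorem not_participates_of_mem_Ioo_pairFlightStart (hz : z ∈ Φ.good) (i j : Fin (N + 1)) {s u : ℝ}
    (hu : u ∈ Ioo (pairFlightStart σ N Φ z i j s) s) :
    ¬ Participates (Torus.geometry (Fin 3)) (hsDiameter σ N) (orbit σ N Φ z u) i ∧
      ¬ Participates (Torus.geometry (Fin 3)) (hsDiameter σ N) (orbit σ N Φ z u) j :=
  ⟨(isTraj hz).not_participates_of_mem_Ioo_flightStart ⟨(le_max_left _ _).trans_lt hu.1, hu.2⟩,
    (isTraj hz).not_participates_of_mem_Ioo_flightStart ⟨(le_max_right _ _).trans_lt hu.1, hu.2⟩⟩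

/-- **The break points of a pair are a previous-point system.**  For the finite set `T` of times
consisting of `0`, `τ` and the participation times of `i` or `j` in `[0, τ]`, the pair flight start
satisfies the hypotheses of `setIntegral_Icc_eq_sum_pieces`. [folklore] -/
theorem pairPieces_hyps (hz : z ∈ Φ.good) {τ : ℝ} (hτ : 0 ≤ τ) {i j : Fin (N + 1)} {T : Finset ℝ}
    (hTmem : ∀ s, s ∈ T ↔ s = 0 ∨ s = τ ∨ (s ∈ Icc 0 τ ∧
      (Participates (Torus.geometry (Fin 3)) (hsDiameter σ N) (orbit σ N Φ z s) i ∨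
        Participates (Torus.geometry (Fin 3)) (hsDiameter σ N) (orbit σ N Φ z s) j))) :
    τ ∈ T ∧ (∀ b ∈ T, 0 ≤ b ∧ b ≤ τ) ∧ (∀ b ∈ T, 0 ≤ pairFlightStart σ N Φ z i j b) ∧
      (∀ b ∈ T, 0 < b → pairFlightStart σ N Φ z i j b < b) ∧
      (∀ b ∈ T, 0 < b → pairFlightStart σ N Φ z i j b ∈ T) ∧
      (∀ b ∈ T, 0 < b → ∀ u ∈ T, ¬ (pairFlightStart σ N Φ z i j b < u ∧ u < b)) := by
  have hTb : ∀ b ∈ T, 0 ≤ b ∧ b ≤ τ := by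
    intro b hb
    rcases (hTmem b).1 hb with rfl | rfl | ⟨hb, -⟩
    · exact ⟨le_rfl, hτ⟩
    · exact ⟨hτ, le_rfl⟩
    · exact hb
  refine ⟨(hTmem τ).2 (Or.inr (Or.inl rfl)), hTb, fun b _ => pairFlightStart_nonneg hz i j b,
    fun b _ hb0 => pairFlightStart_lt hz i j hb0, fun b hb hb0 => ?_, fun b hb hb0 u hu huu => ?_⟩
  · rcases pairFlightStart_eq_zero_or hz i j b with h0 | ⟨hI, hP⟩
    · rw [h0]; exact (hTmem 0).2 (Or.inl rfl)
    · exact (hTmem _).2 (Or.inr (Or.inr ⟨⟨hI.1.le, hI.2.le.trans (hTb b hb).2⟩, hP⟩))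
  · obtain ⟨hni, hnj⟩ := not_participates_of_mem_Ioo_pairFlightStart hz i j (s := b) (u := u) huu
    rcases (hTmem u).1 hu with rfl | rfl | ⟨-, hP⟩
    · exact (not_le.2 huu.1) (pairFlightStart_nonneg hz i j b)
    · exact (not_le.2 huu.2) (hTb b hb).2
    · exact hP.elim hni hnj

end PairPieces

end Literature.MathematicalPhysics.KineticTheory

end
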